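import Literature.Analysis.FluidPDE.BoundedMildSmoothRemainder
import Literature.Analysis.FluidPDE.StokesLocalEnergyEquality
import Literature.Analysis.FluidPDE.SereginSverakLocalHolderTools
import Literature.Analysis.FluidPDE.ClassicalSuitable
import Literature.Analysis.FluidPDE.CaloricLocalLerayLp
import Literature.Analysis.FluidPDE.LocalEnergyConcatenation
import Literature.Analysis.FluidPDE.KatoUniquenessDual
import HarnessLib

/-!
# The remainder `w = u − E` of a bounded mild solution solves a forced Stokes system

Analysis/FluidPDE support file (theorems only) on the discharge path of
`Literature.Analysis.FluidPDE.AlbrittonBarker2019_liouville_weakL3_backward` (Barker–Seregin–Šverák,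
arXiv:1603.03211, Lemma 3.4: the global energy method for `w = u − E`, `E` a divergence-free
caloric field). On the open slab `Q = (0, S) × ℝ³`:

* `setIntegral_slab_caloric_eq_zero` — a classical divergence-free caloric field `E` on
  `(0, ∞) × ℝ³` (jointly continuous with `∇E`, `ΔE`, `C²` slices, `∂ₜE = ΔE` pointwise) satisfies
  `∫∫_Q (⟪E, ∂ₜψ⟫ + ⟪E, Δψ⟫) = 0` for all tests `ψ ∈ C_c^∞(Q)` (fundamental theorem of calculus
  in `t`, Green's second identity in `x`, Fubini);
* `setIntegral_slab_inner_convect_eq_neg` — for the KNSS-smooth bounded mild solution `u`,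
  `∫∫_Q ⟪u, (u·∇)ψ⟫ = −∫∫_Q ⟪(u·∇)u, ψ⟫`;
* `isDistributionalStokesSolutionOn_remainder` — with the Riesz pressure `p` of `u`
  (`isDistributionalNSSolutionOn_slab_of_oseenForward`), the pair `(u − E, p)` is a distributional
  solution of the Stokes system on `Q` with force `f = −(u·∇)u`
  (`IsDistributionalStokesSolutionOn`), and `∇(u − E)` (classical) is its weak spatial gradient;
* `remainder_local_energy_equality` — hence CKN's local energy *equality*
  `2∫∫|∇w|²φ = ∫∫ (|w|²(∂ₜφ + Δφ) + 2p⟪w, ∇φ⟫ + 2⟪f, w⟫φ)` for every `φ ∈ C_c^∞(Q)`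
  (`IsDistributionalStokesSolutionOn.local_energy_equality`).

## References

* T. Barker, G. Seregin, V. Šverák, *On stability of weak Navier–Stokes solutions with large
  `L^{3,∞}` initial data*, arXiv:1603.03211, Lemma 3.4. [`BarkerSeregin2016`]
* L. Caffarelli, R. Kohn, L. Nirenberg, CPAM 35 (1982), §2 (2.1)–(2.5).
  [`CaffarelliKohnNirenberg1982`]
-/

noncomputable section

open MeasureTheory Set Function Filter Metric TopologicalSpace InnerProductSpace
open _root_.Topology
open scoped NNReal ENNReal Laplacian RealInnerProductSpace ContDiff

namespace Literature.Analysis.FluidPDE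

open UnboundedOperators FunctionSpaces

variable {S : ℝ}

/-! ### Integrability helpers on the slab -/

/-- A function continuous on the open slab `(0, S) × ℝ³` and vanishing off a compact subset of
it is integrable (on the slab and on the whole space–time). [folklore] -/
theorem integrable_of_continuousOn_slab_of_eq_zero_off {G : Type*} [NormedAddCommGroup G]
    {F : ℝ × EuclideanSpace ℝ (Fin 3) → G}
    (hF : ContinuousOn F (Ioo 0 S ×ˢ (univ : Set (EuclideanSpace ℝ (Fin 3)))))
    {K : Set (ℝ × EuclideanSpace ℝ (Fin 3))} (hK : IsCompact K)
    (hKQ : K ⊆ Ioo 0 S ×ˢ (univ : Set (EuclideanSpace ℝ (Fin 3)))) (h0 : ∀ z ∉ K, F z = 0) :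
    Integrable F (volume : Measure (ℝ × EuclideanSpace ℝ (Fin 3))) ∧
      IntegrableOn F (Ioo 0 S ×ˢ (univ : Set (EuclideanSpace ℝ (Fin 3)))) volume := by
  have hIK : IntegrableOn F K volume := (hF.mono hKQ).integrableOn_compact hK
  have hI : Integrable F (volume : Measure (ℝ × EuclideanSpace ℝ (Fin 3))) := by
    rw [← integrableOn_univ]
    exact hIK.of_forall_sdiff_eq_zero MeasurableSet.univ fun z hz => h0 z hz.2
  exact ⟨hI, hI.integrableOn⟩

/-- `∫_{(0,S) × ℝ³} F = ∫_{ℝ × ℝ³} F` for `F` vanishing off a subset of the slab. [folklore] -/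
theorem setIntegral_slab_eq_integral_of_eq_zero_off {G : Type*} [NormedAddCommGroup G] [NormedSpace ℝ G]
    {F : ℝ × EuclideanSpace ℝ (Fin 3) → G} {K : Set (ℝ × EuclideanSpace ℝ (Fin 3))}
    (hKQ : K ⊆ Ioo 0 S ×ˢ (univ : Set (EuclideanSpace ℝ (Fin 3)))) (h0 : ∀ z ∉ K, F z = 0) :
    ∫ z in Ioo 0 S ×ˢ (univ : Set (EuclideanSpace ℝ (Fin 3))), F z = ∫ z, F z :=
  setIntegral_eq_integral_of_forall_compl_eq_zero fun z hz => h0 z fun hzK => hz (hKQ hzK)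

/-! ### Classical caloric fields are distributional solutions of the heat equation on the slab -/

section Caloric

variable {E' : ℝ → EuclideanSpace ℝ (Fin 3) → EuclideanSpace ℝ (Fin 3)}

/-- **A classical caloric field is a distributional solution of the heat equation on the slab**:
if `E` is jointly continuous on `(0, ∞) × ℝ³` together with `ΔE`, has `C²` slices and
`∂ₜE(t, x) = ΔE(t)(x)` for `t > 0`, then `∫∫_{(0,S)×ℝ³} (⟪E, ∂ₜψ⟫ + ⟪E, Δψ⟫) = 0` for every
`ψ ∈ C_c^∞((0, S) × ℝ³; ℝ³)` (FTC in time on each line `x = const`, Green's identity on each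
slice, Fubini). [folklore] -/
theorem setIntegral_slab_caloric_eq_zero (hS : 0 < S)
    (hEc : ContinuousOn (fun q : ℝ × EuclideanSpace ℝ (Fin 3) => E' q.1 q.2) (Ioi 0 ×ˢ univ))
    (hEΔc : ContinuousOn (fun q : ℝ × EuclideanSpace ℝ (Fin 3) => (Δ (E' q.1)) q.2) (Ioi 0 ×ˢ univ))
    (hEsm : ∀ t, 0 < t → ContDiff ℝ 2 (E' t))
    (hEt : ∀ t, 0 < t → ∀ x, HasDerivAt (fun s => E' s x) ((Δ (E' t)) x) t)
    {ψ : ℝ → EuclideanSpace ℝ (Fin 3) → EuclideanSpace ℝ (Fin 3)}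
    (hψ : IsSpaceTimeTestOn (slab (EuclideanSpace ℝ (Fin 3)) (Ioo 0 S) isOpen_Ioo) ψ) :
    ∫ z in Ioo 0 S ×ˢ (univ : Set (EuclideanSpace ℝ (Fin 3))),
      (⟪E' z.1 z.2, timeDeriv ψ z.1 z.2⟫ + ⟪E' z.1 z.2, (Δ (ψ z.1)) z.2⟫) = 0 := by
  -- supports
  set K : Set (ℝ × EuclideanSpace ℝ (Fin 3)) := tsupport (uncurry ψ) with hK_def
  have hK : IsCompact K := hψ.hasCompactSupport
  have hKQ : K ⊆ Ioo 0 S ×ˢ (univ : Set (EuclideanSpace ℝ (Fin 3))) := hψ.tsupport_subset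
  obtain ⟨a, b, ha, hab, hb, hsupp⟩ := hψ.exists_time_support_Ioo hS
  have hψ0 : ∀ z : ℝ × EuclideanSpace ℝ (Fin 3), z ∉ K → ψ z.1 z.2 = 0 := fun z hz =>
    show uncurry ψ z = 0 from image_eq_zero_of_notMem_tsupport hz
  have hdt0 : ∀ z : ℝ × EuclideanSpace ℝ (Fin 3), z ∉ K → timeDeriv ψ z.1 z.2 = 0 := fun z hz =>
    timeDeriv_eq_zero_off_tsupport hz
  have hΔ0 : ∀ z : ℝ × EuclideanSpace ℝ (Fin 3), z ∉ K → (Δ (ψ z.1)) z.2 = 0 := fun z hz =>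
    laplacian_eq_zero_of_notMem_tsupport (notMem_tsupport_slice_of_notMem hz)
  have hQI : Ioo 0 S ×ˢ (univ : Set (EuclideanSpace ℝ (Fin 3))) ⊆ Ioi 0 ×ˢ univ :=
    prod_mono (fun t ht => ht.1) Subset.rfl
  have hψt : ∀ t, t ∉ Icc a b → ∀ x, ψ t x = 0 := fun t ht x => by rw [hsupp t ht]; rfl
  -- continuity of the data of the test field
  have cψ : Continuous (uncurry ψ) := hψ.contDiff.continuous
  have cdt : Continuous (uncurry (timeDeriv ψ)) := hψ.continuous_timeDeriv
  have cΔψ : Continuous fun z : ℝ × EuclideanSpace ℝ (Fin 3) => (Δ (ψ z.1)) z.2 :=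
    hψ.continuous_laplacian_slice
  -- the three integrands
  set F₁ : ℝ × EuclideanSpace ℝ (Fin 3) → ℝ := fun z => ⟪E' z.1 z.2, timeDeriv ψ z.1 z.2⟫ with hF₁
  set F₂ : ℝ × EuclideanSpace ℝ (Fin 3) → ℝ := fun z => ⟪E' z.1 z.2, (Δ (ψ z.1)) z.2⟫ with hF₂
  set F₃ : ℝ × EuclideanSpace ℝ (Fin 3) → ℝ := fun z => ⟪(Δ (E' z.1)) z.2, ψ z.1 z.2⟫ with hF₃
  have hF₁0 : ∀ z ∉ K, F₁ z = 0 := fun z hz => by simp only [hF₁, hdt0 z hz, inner_zero_right]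
  have hF₂0 : ∀ z ∉ K, F₂ z = 0 := fun z hz => by simp only [hF₂, hΔ0 z hz, inner_zero_right]
  have hF₃0 : ∀ z ∉ K, F₃ z = 0 := fun z hz => by simp only [hF₃, hψ0 z hz, inner_zero_right]
  have cF₁ : ContinuousOn F₁ (Ioo 0 S ×ˢ univ) :=
    (hEc.mono hQI).inner cdt.continuousOn
  have cF₂ : ContinuousOn F₂ (Ioo 0 S ×ˢ univ) :=
    (hEc.mono hQI).inner cΔψ.continuousOn
  have cF₃ : ContinuousOn F₃ (Ioo 0 S ×ˢ univ) :=
    (hEΔc.mono hQI).inner cψ.continuousOn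
  obtain ⟨iF₁, -⟩ := integrable_of_continuousOn_slab_of_eq_zero_off cF₁ hK hKQ hF₁0
  obtain ⟨iF₂, -⟩ := integrable_of_continuousOn_slab_of_eq_zero_off cF₂ hK hKQ hF₂0
  obtain ⟨iF₃, -⟩ := integrable_of_continuousOn_slab_of_eq_zero_off cF₃ hK hKQ hF₃0
  -- `K` lies over the time interval `[a, b]`
  have hKt : ∀ z ∈ K, z.1 ∈ Icc a b := by
    have hcl : IsClosed (Icc a b ×ˢ (univ : Set (EuclideanSpace ℝ (Fin 3)))) :=
      isClosed_Icc.prod isClosed_univ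
    have hsub : support (uncurry ψ) ⊆ Icc a b ×ˢ (univ : Set (EuclideanSpace ℝ (Fin 3))) := by
      intro z hz
      refine ⟨?_, mem_univ _⟩
      by_contra h
      exact hz (by simp [uncurry, hsupp z.1 h])
    exact fun z hz => (closure_minimal hsub hcl hz).1
  -- slice integrability for `t > 0`
  have hEt_cont : ∀ t, 0 < t → Continuous (E' t) := fun t ht =>
    (hEc.comp_continuous (f := fun x : EuclideanSpace ℝ (Fin 3) => (t, x)) (by fun_prop)
      fun x => ⟨ht, mem_univ _⟩ :)
  have hΔEt_cont : ∀ t, 0 < t → Continuous fun x => (Δ (E' t)) x := fun t ht =>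
    (hEΔc.comp_continuous (f := fun x : EuclideanSpace ℝ (Fin 3) => (t, x)) (by fun_prop)
      fun x => ⟨ht, mem_univ _⟩ :)
  have hψc : ∀ t, HasCompactSupport (ψ t) := fun t => hψ.hasCompactSupport_slice t
  have hcs : ∀ (t : ℝ) (g : EuclideanSpace ℝ (Fin 3) → EuclideanSpace ℝ (Fin 3))
      (w : EuclideanSpace ℝ (Fin 3) → EuclideanSpace ℝ (Fin 3)),
      (∀ x, (t, x) ∉ K → w x = 0) → HasCompactSupport fun x => ⟪g x, w x⟫ := by
    intro t g w hw
    have hKx : IsCompact ((fun x : EuclideanSpace ℝ (Fin 3) => (t, x)) ⁻¹' K) :=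
      (hK.image continuous_snd).of_isClosed_subset (hK.isClosed.preimage (Continuous.prodMk_right t))
        fun x hx => ⟨(t, x), hx, rfl⟩
    exact HasCompactSupport.intro hKx fun x hx => by rw [hw x hx, inner_zero_right]
  have i1 : ∀ t, 0 < t → Integrable (fun x => F₁ (t, x)) volume := fun t ht =>
    ((hEt_cont t ht).inner (cdt.comp (Continuous.prodMk_right t))).integrable_of_hasCompactSupport
      (hcs t _ _ fun x hx => hdt0 (t, x) hx)
  have i2 : ∀ t, 0 < t → Integrable (fun x => F₂ (t, x)) volume := fun t ht =>
    ((hEt_cont t ht).inner (cΔψ.comp (Continuous.prodMk_right t))).integrable_of_hasCompactSupport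
      (hcs t _ _ fun x hx => hΔ0 (t, x) hx)
  have i3 : ∀ t, 0 < t → Integrable (fun x => F₃ (t, x)) volume := fun t ht => by
    have hc3 : HasCompactSupport fun x => ⟪(Δ (E' t)) x, ψ t x⟫ :=
      hcs t _ _ fun x hx => hψ0 (t, x) hx
    exact ((hΔEt_cont t ht).inner (cψ.comp (Continuous.prodMk_right t))).integrable_of_hasCompactSupport hc3
  -- Step 1: pass to the whole space–time and to iterated integrals
  have h12K : ∀ z ∉ K, F₁ z + F₂ z = 0 := fun z hz => by rw [hF₁0 z hz, hF₂0 z hz, add_zero]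
  have i12 : Integrable (fun z : ℝ × EuclideanSpace ℝ (Fin 3) => F₁ z + F₂ z)
      ((volume : Measure ℝ).prod (volume : Measure (EuclideanSpace ℝ (Fin 3)))) := by
    have h := iF₁.add iF₂; rwa [Measure.volume_eq_prod] at h
  have i13 : Integrable (fun z : ℝ × EuclideanSpace ℝ (Fin 3) => F₁ z + F₃ z)
      ((volume : Measure ℝ).prod (volume : Measure (EuclideanSpace ℝ (Fin 3)))) := by
    have h := iF₁.add iF₃; rwa [Measure.volume_eq_prod] at h
  change ∫ z in Ioo 0 S ×ˢ (univ : Set (EuclideanSpace ℝ (Fin 3))), (F₁ z + F₂ z) = 0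
  rw [setIntegral_slab_eq_integral_of_eq_zero_off hKQ h12K, Measure.volume_eq_prod, integral_prod _ i12]
  -- Step 2: Green's identity on each slice: `∫ (F₁ + F₂)(t, ·) = ∫ (F₁ + F₃)(t, ·)`
  have hslice : ∀ t, ∫ x, (F₁ (t, x) + F₂ (t, x)) = ∫ x, (F₁ (t, x) + F₃ (t, x)) := by
    intro t
    by_cases ht : 0 < t
    · rw [integral_add (i1 t ht) (i2 t ht), integral_add (i1 t ht) (i3 t ht)]
      congr 1
      exact (integral_inner_laplacian_comm (hEsm t ht) (hψ.contDiff_slice_two t) (hψc t)).symm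
    · have h0 : ∀ x, ψ t x = 0 := hψt t fun h => ht (ha.trans_le h.1)
      have hΔψ : ∀ x, (Δ (ψ t)) x = 0 := fun x => by
        have : ψ t = 0 := funext h0
        rw [this]; exact laplacian_eq_zero_of_notMem_tsupport (by simp)
      simp only [hF₂, hF₃, h0, hΔψ, inner_zero_right]
  simp_rw [show ∀ t, (∫ x, (fun z : ℝ × EuclideanSpace ℝ (Fin 3) => F₁ z + F₂ z) (t, x)) =
      ∫ x, (F₁ (t, x) + F₃ (t, x)) from hslice]
  -- Step 3: swap the integrals and integrate the time derivative of `⟪E, ψ⟫` along each line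
  rw [integral_integral_swap (i13.congr (Eventually.of_forall fun z => by simp [uncurry]))]
  refine integral_eq_zero_of_ae (Eventually.of_forall fun x => ?_)
  set a₀ : ℝ := a / 2 with ha₀
  set b₀ : ℝ := (b + S) / 2 with hb₀
  have ha₀0 : 0 < a₀ := by positivity
  have ha₀a : a₀ < a := by rw [ha₀]; linarith
  have hbb₀ : b < b₀ := by rw [hb₀]; linarith
  have hab₀ : a₀ ≤ b₀ := by linarith
  set G : ℝ → ℝ := fun t => F₁ (t, x) + F₃ (t, x) with hG
  have hG0 : ∀ t, t ∉ Icc a b → G t = 0 := fun t ht => by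
    have hz : ((t, x) : ℝ × EuclideanSpace ℝ (Fin 3)) ∉ K := fun h => ht (hKt _ h)
    simp only [hG, hF₁0 _ hz, hF₃0 _ hz, add_zero]
  have hsuppG : support G ⊆ Ioc a₀ b₀ := by
    intro t ht
    by_contra h
    exact ht (hG0 t fun h' => h ⟨ha₀a.trans_le h'.1, h'.2.trans hbb₀.le⟩)
  change ∫ t, G t = 0
  rw [← intervalIntegral.integral_eq_integral_of_support_subset hsuppG]
  -- FTC for `h(t) = ⟪E(t, x), ψ(t, x)⟫` on `[a₀, b₀] ⊂ (0, ∞)`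
  have hderiv : ∀ t ∈ uIcc a₀ b₀, HasDerivAt (fun s => ⟪E' s x, ψ s x⟫) (G t) t := by
    intro t ht
    rw [uIcc_of_le hab₀] at ht
    have ht0 : 0 < t := ha₀0.trans_le ht.1
    have h := (hEt t ht0 x).inner ℝ (hψ.hasDerivAt_time t x)
    simp only [hG, hF₁, hF₃]
    convert h using 1
  have hcontG : ContinuousOn G (uIcc a₀ b₀) := by
    rw [uIcc_of_le hab₀]
    have hline : ∀ t ∈ Icc a₀ b₀, ((t, x) : ℝ × EuclideanSpace ℝ (Fin 3)) ∈ Ioi (0 : ℝ) ×ˢ (univ : Set (EuclideanSpace ℝ (Fin 3))) :=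
      fun t ht => ⟨ha₀0.trans_le ht.1, mem_univ _⟩
    have c1 : ContinuousOn (fun t : ℝ => E' t x) (Icc a₀ b₀) :=
      hEc.comp (f := fun t : ℝ => ((t, x) : ℝ × EuclideanSpace ℝ (Fin 3))) (by fun_prop) hline
    have c3 : ContinuousOn (fun t : ℝ => (Δ (E' t)) x) (Icc a₀ b₀) :=
      hEΔc.comp (f := fun t : ℝ => ((t, x) : ℝ × EuclideanSpace ℝ (Fin 3))) (by fun_prop) hline
    have c2 : Continuous fun t : ℝ => timeDeriv ψ t x := cdt.comp (Continuous.prodMk_left x)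
    have c4 : Continuous fun t : ℝ => ψ t x := cψ.comp (Continuous.prodMk_left x)
    exact (c1.inner c2.continuousOn).add (c3.inner c4.continuousOn)
  rw [intervalIntegral.integral_eq_sub_of_hasDerivAt hderiv (hcontG.intervalIntegrable)]
  have hb0 : ψ b₀ x = 0 := hψt b₀ (fun h => by linarith [h.2]) x
  have ha0 : ψ a₀ x = 0 := hψt a₀ (fun h => by linarith [h.1]) x
  simp [hb0, ha0]

end Caloric

/-! ### The convective term of the smooth bounded mild solution -/

section Convective

variable {u : ℝ → EuclideanSpace ℝ (Fin 3) → EuclideanSpace ℝ (Fin 3)}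

/-- Test-field supports: a function vanishing off `tsupport ψ ⊆ Q` has compact support in `Q`. [folklore] -/
theorem hasCompactSupport_of_eq_zero_off_tsupport {G : Type*} [Zero G] [TopologicalSpace G]
    {F : Type*} [NormedAddCommGroup F] [NormedSpace ℝ F]
    {Q : Opens (ℝ × EuclideanSpace ℝ (Fin 3))}
    {ψ : ℝ → EuclideanSpace ℝ (Fin 3) → F} (hψ : IsSpaceTimeTestOn Q ψ)
    {Ψ : ℝ × EuclideanSpace ℝ (Fin 3) → G} (h0 : ∀ z ∉ tsupport (uncurry ψ), Ψ z = 0) :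
    HasCompactSupport Ψ ∧ tsupport Ψ ⊆ (Q : Set (ℝ × EuclideanSpace ℝ (Fin 3))) :=
  ⟨HasCompactSupport.intro hψ.hasCompactSupport h0,
    (closure_minimal (support_subset_iff'.2 h0) hψ.hasCompactSupport.isClosed).trans hψ.tsupport_subset⟩

/-- **`∫∫ ⟪u, (u·∇)ψ⟫ = −∫∫ ⟪(u·∇)u, ψ⟫` on the slab** for the bounded mild solution `u`
(smooth and divergence free for `t ∈ (0, S)` by KNSS; slice-wise integration by parts
`integral_inner_convect_add_eq_zero`, then Fubini), together with the integrability of both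
integrands on the slab. [cite: KochNadirashviliSereginSverak2009, §4 (4.10)–(4.11) (arXiv:0709.3599v1 p. 8)] -/
theorem setIntegral_slab_inner_convect_eq_neg (hS : 0 < S)
    (hcont : ContinuousOn (uncurry u) (Icc 0 S ×ˢ univ)) {K : ℝ}
    (hK : ∀ t ∈ Icc 0 S, ∀ x, ‖u t x‖ ≤ K) (hdiv : ∀ t ∈ Icc 0 S, IsWeaklyDivFree (u t))
    (hmild : ∀ s t : ℝ, 0 ≤ s → s < t → t ≤ S → ∀ x,
      u t x = heatExtension (u s) (t - s) x - oseenDuhamel 1 s u u t x)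
    {ψ : ℝ → EuclideanSpace ℝ (Fin 3) → EuclideanSpace ℝ (Fin 3)}
    (hψ : IsSpaceTimeTestOn (slab (EuclideanSpace ℝ (Fin 3)) (Ioo 0 S) isOpen_Ioo) ψ) :
    IntegrableOn (fun z : ℝ × EuclideanSpace ℝ (Fin 3) => ⟪u z.1 z.2, convect (u z.1) (ψ z.1) z.2⟫)
        (Ioo 0 S ×ˢ (univ : Set (EuclideanSpace ℝ (Fin 3)))) volume ∧
      IntegrableOn (fun z : ℝ × EuclideanSpace ℝ (Fin 3) => ⟪fderiv ℝ (u z.1) z.2 (u z.1 z.2), ψ z.1 z.2⟫)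
        (Ioo 0 S ×ˢ (univ : Set (EuclideanSpace ℝ (Fin 3)))) volume ∧
      ∫ z in Ioo 0 S ×ˢ (univ : Set (EuclideanSpace ℝ (Fin 3))), ⟪u z.1 z.2, convect (u z.1) (ψ z.1) z.2⟫ =
        -∫ z in Ioo 0 S ×ˢ (univ : Set (EuclideanSpace ℝ (Fin 3))),
          ⟪fderiv ℝ (u z.1) z.2 (u z.1 z.2), ψ z.1 z.2⟫ := by
  obtain ⟨hsm, hdf, -, -⟩ := smooth_of_oseenForward hS hcont hK hdiv hmild
  have hDu := continuousOn_fderiv_of_oseenForward hS hcont hK hdiv hmild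
  set Kψ : Set (ℝ × EuclideanSpace ℝ (Fin 3)) := tsupport (uncurry ψ) with hKψ
  have hKc : IsCompact Kψ := hψ.hasCompactSupport
  have hKQ : Kψ ⊆ Ioo 0 S ×ˢ (univ : Set (EuclideanSpace ℝ (Fin 3))) := hψ.tsupport_subset
  have hψ0 : ∀ z : ℝ × EuclideanSpace ℝ (Fin 3), z ∉ Kψ → ψ z.1 z.2 = 0 := fun z hz =>
    show uncurry ψ z = 0 from image_eq_zero_of_notMem_tsupport hz
  have hDψ0 : ∀ z : ℝ × EuclideanSpace ℝ (Fin 3), z ∉ Kψ → fderiv ℝ (ψ z.1) z.2 = 0 := fun z hz =>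
    fderiv_of_notMem_tsupport ℝ (notMem_tsupport_slice_of_notMem hz)
  have cψ : Continuous (uncurry ψ) := hψ.contDiff.continuous
  have cDψ : Continuous fun z : ℝ × EuclideanSpace ℝ (Fin 3) => fderiv ℝ (ψ z.1) z.2 :=
    (hψ.mono le_top).fderiv_top.contDiff.continuous
  have cu : ContinuousOn (fun z : ℝ × EuclideanSpace ℝ (Fin 3) => u z.1 z.2) (Ioo 0 S ×ˢ univ) :=
    hcont.mono (prod_mono Ioo_subset_Icc_self Subset.rfl)
  -- the two integrands
  set F₄ : ℝ × EuclideanSpace ℝ (Fin 3) → ℝ := fun z => ⟪u z.1 z.2, convect (u z.1) (ψ z.1) z.2⟫ with hF₄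
  set F₅ : ℝ × EuclideanSpace ℝ (Fin 3) → ℝ := fun z => ⟪fderiv ℝ (u z.1) z.2 (u z.1 z.2), ψ z.1 z.2⟫ with hF₅
  have hF₄0 : ∀ z ∉ Kψ, F₄ z = 0 := fun z hz => by
    simp only [hF₄, convect, hDψ0 z hz, zero_apply, inner_zero_right]
  have hF₅0 : ∀ z ∉ Kψ, F₅ z = 0 := fun z hz => by simp only [hF₅, hψ0 z hz, inner_zero_right]
  have cF₄ : ContinuousOn F₄ (Ioo 0 S ×ˢ univ) :=
    cu.inner ((cDψ.continuousOn).clm_apply cu)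
  have cF₅ : ContinuousOn F₅ (Ioo 0 S ×ˢ univ) := (hDu.clm_apply cu).inner cψ.continuousOn
  obtain ⟨-, iF₄⟩ := integrable_of_continuousOn_slab_of_eq_zero_off cF₄ hKc hKQ hF₄0
  obtain ⟨-, iF₅⟩ := integrable_of_continuousOn_slab_of_eq_zero_off cF₅ hKc hKQ hF₅0
  refine ⟨iF₄, iF₅, ?_⟩
  change ∫ z in Ioo 0 S ×ˢ (univ : Set (EuclideanSpace ℝ (Fin 3))), F₄ z =
    -∫ z in Ioo 0 S ×ˢ (univ : Set (EuclideanSpace ℝ (Fin 3))), F₅ z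
  rw [LocalEnergyConcat.setIntegral_slab_eq_integral_integral iF₄,
    LocalEnergyConcat.setIntegral_slab_eq_integral_integral iF₅, ← integral_neg]
  refine setIntegral_congr_fun measurableSet_Ioo fun t ht => ?_
  -- slice-wise integration by parts with `div u(t) = 0`
  have hu1 : ContDiff ℝ 1 (u t) := (hsm t ht).of_le (by exact_mod_cast le_top)
  have hψ1 : ContDiff ℝ 1 (ψ t) := (hψ.contDiff_slice t).of_le (by exact_mod_cast le_top)
  have h := integral_inner_convect_add_eq_zero hu1 hu1 hψ1 (hψ.hasCompactSupport_slice t)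
  have hdiv0 : (fun x => VectorCalculus.divergence (u t) x * ⟪u t x, ψ t x⟫) = fun _ => 0 := by
    funext x; rw [hdf t ht x, zero_mul]
  rw [hdiv0, integral_zero, add_zero] at h
  change ∫ x, ⟪u t x, convect (u t) (ψ t) x⟫ = -∫ x, ⟪fderiv ℝ (u t) x (u t x), ψ t x⟫
  have hc : ∫ x, ⟪fderiv ℝ (u t) x (u t x), ψ t x⟫ = ∫ x, ⟪convect (u t) (u t) x, ψ t x⟫ := rfl
  linarith

end Convective

/-! ### The Stokes system for the remainder and its local energy equality -/

section Stokes

variable {u E' : ℝ → EuclideanSpace ℝ (Fin 3) → EuclideanSpace ℝ (Fin 3)}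
  {p : ℝ → EuclideanSpace ℝ (Fin 3) → ℝ}

/-- **The remainder solves a forced Stokes system.** Let `u` be a bounded, jointly continuous,
weakly divergence-free solution of the Oseen integral equation on `[0, S] × ℝ³`, `p` a pressure
for which `(u, p)` solves Navier–Stokes in `𝒟'((0,S) × ℝ³)`, and `E` a classical divergence-free
caloric field on `(0, ∞) × ℝ³`. Then `(u − E, p)` solves the Stokes system in `𝒟'((0,S) × ℝ³)`
with force `−(u·∇)u`, and the classical `∇(u − E)` is a weak spatial gradient of `u − E`
(Barker–Seregin–Šverák 2016, proof of Lemma 3.4: the equation for `w = u − E`).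
[cite: BarkerSeregin2016, Lemma 3.4 (proof)] -/
theorem isDistributionalStokesSolutionOn_remainder (hS : 0 < S)
    (hcont : ContinuousOn (uncurry u) (Icc 0 S ×ˢ univ)) {K : ℝ}
    (hK : ∀ t ∈ Icc 0 S, ∀ x, ‖u t x‖ ≤ K) (hdiv : ∀ t ∈ Icc 0 S, IsWeaklyDivFree (u t))
    (hmild : ∀ s t : ℝ, 0 ≤ s → s < t → t ≤ S → ∀ x,
      u t x = heatExtension (u s) (t - s) x - oseenDuhamel 1 s u u t x)
    (hEc : ContinuousOn (fun q : ℝ × EuclideanSpace ℝ (Fin 3) => E' q.1 q.2) (Ioi 0 ×ˢ univ))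
    (hEDc : ContinuousOn (fun q : ℝ × EuclideanSpace ℝ (Fin 3) => fderiv ℝ (E' q.1) q.2) (Ioi 0 ×ˢ univ))
    (hEΔc : ContinuousOn (fun q : ℝ × EuclideanSpace ℝ (Fin 3) => (Δ (E' q.1)) q.2) (Ioi 0 ×ˢ univ))
    (hEsm : ∀ t, 0 < t → ContDiff ℝ 2 (E' t)) (hEdiv : ∀ t, 0 < t → VectorCalculus.IsDivFree (E' t))
    (hEt : ∀ t, 0 < t → ∀ x, HasDerivAt (fun s => E' s x) ((Δ (E' t)) x) t)
    (hNS : IsDistributionalNSSolutionOn (slab (EuclideanSpace ℝ (Fin 3)) (Ioo 0 S) isOpen_Ioo) 1 0 u p) :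
    IsDistributionalStokesSolutionOn (slab (EuclideanSpace ℝ (Fin 3)) (Ioo 0 S) isOpen_Ioo)
        (fun t x => -(fderiv ℝ (u t) x (u t x))) (fun t x => u t x - E' t x) p ∧
      HasWeakSpatialGradientOn (slab (EuclideanSpace ℝ (Fin 3)) (Ioo 0 S) isOpen_Ioo)
        (fun t x => u t x - E' t x) (fun t x => fderiv ℝ (u t) x - fderiv ℝ (E' t) x) := by
  obtain ⟨hsm, hdf, -, -⟩ := smooth_of_oseenForward hS hcont hK hdiv hmild
  have hDu := continuousOn_fderiv_of_oseenForward hS hcont hK hdiv hmild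
  have hQI : Ioo 0 S ×ˢ (univ : Set (EuclideanSpace ℝ (Fin 3))) ⊆ Ioi 0 ×ˢ univ :=
    prod_mono (fun t ht => ht.1) Subset.rfl
  have hSm : MeasurableSet (Ioo 0 S ×ˢ (univ : Set (EuclideanSpace ℝ (Fin 3)))) :=
    measurableSet_Ioo.prod MeasurableSet.univ
  have cu : ContinuousOn (fun z : ℝ × EuclideanSpace ℝ (Fin 3) => u z.1 z.2) (Ioo 0 S ×ˢ univ) :=
    hcont.mono (prod_mono Ioo_subset_Icc_self Subset.rfl)
  have cE : ContinuousOn (fun z : ℝ × EuclideanSpace ℝ (Fin 3) => E' z.1 z.2) (Ioo 0 S ×ˢ univ) :=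
    hEc.mono hQI
  have cw : ContinuousOn (uncurry fun t x => u t x - E' t x) (Ioo 0 S ×ˢ univ) := cu.sub cE
  have cG : ContinuousOn (uncurry fun t x => fderiv ℝ (u t) x - fderiv ℝ (E' t) x) (Ioo 0 S ×ˢ univ) :=
    hDu.sub (hEDc.mono hQI)
  have hEloc : LocallyIntegrableOn (uncurry E')
      ((slab (EuclideanSpace ℝ (Fin 3)) (Ioo 0 S) isOpen_Ioo : Opens (ℝ × EuclideanSpace ℝ (Fin 3))) :
        Set (ℝ × EuclideanSpace ℝ (Fin 3))) volume :=
    cE.locallyIntegrableOn hSm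
  have hwloc : LocallyIntegrableOn (uncurry fun t x => u t x - E' t x)
      ((slab (EuclideanSpace ℝ (Fin 3)) (Ioo 0 S) isOpen_Ioo : Opens (ℝ × EuclideanSpace ℝ (Fin 3))) :
        Set (ℝ × EuclideanSpace ℝ (Fin 3))) volume :=
    cw.locallyIntegrableOn hSm
  have hfloc : LocallyIntegrableOn (uncurry fun t x => -(fderiv ℝ (u t) x (u t x)))
      ((slab (EuclideanSpace ℝ (Fin 3)) (Ioo 0 S) isOpen_Ioo : Opens (ℝ × EuclideanSpace ℝ (Fin 3))) :
        Set (ℝ × EuclideanSpace ℝ (Fin 3))) volume :=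
    (hDu.clm_apply cu).neg.locallyIntegrableOn hSm
  -- the weak gradient
  have hWG : HasWeakSpatialGradientOn (slab (EuclideanSpace ℝ (Fin 3)) (Ioo 0 S) isOpen_Ioo)
      (fun t x => u t x - E' t x) (fun t x => fderiv ℝ (u t) x - fderiv ℝ (E' t) x) :=
    hasWeakSpatialGradientOn_of_hasFDerivAt (S := Ioo 0 S) Subset.rfl cw cG fun t ht x =>
      (((hsm t ht).differentiable (by simp)) x).hasFDerivAt.sub
        (((hEsm t ht.1).differentiable (by simp)) x).hasFDerivAt
  refine ⟨⟨hwloc, hNS.2.2.1, hfloc, fun θ hθ => ?_, fun ψ hψ => ?_⟩, hWG⟩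
  · -- weak divergence-freeness of `u - E`
    obtain ⟨cgr, -, hgr0⟩ := hθ.continuous_gradient_field
    obtain ⟨hgc, hgQ⟩ := hasCompactSupport_of_eq_zero_off_tsupport hθ hgr0
    have iu : IntegrableOn (fun z : ℝ × EuclideanSpace ℝ (Fin 3) => ⟪u z.1 z.2, gradient (θ z.1) z.2⟫)
        ((slab (EuclideanSpace ℝ (Fin 3)) (Ioo 0 S) isOpen_Ioo : Opens (ℝ × EuclideanSpace ℝ (Fin 3))) :
          Set (ℝ × EuclideanSpace ℝ (Fin 3))) volume :=
      integrableOn_inner_of_tsupport_subset hNS.1 cgr hgc hgQ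
    have iE : IntegrableOn (fun z : ℝ × EuclideanSpace ℝ (Fin 3) => ⟪E' z.1 z.2, gradient (θ z.1) z.2⟫)
        ((slab (EuclideanSpace ℝ (Fin 3)) (Ioo 0 S) isOpen_Ioo : Opens (ℝ × EuclideanSpace ℝ (Fin 3))) :
          Set (ℝ × EuclideanSpace ℝ (Fin 3))) volume :=
      integrableOn_inner_of_tsupport_subset hEloc cgr hgc hgQ
    have hE0 : ∫ z in ((slab (EuclideanSpace ℝ (Fin 3)) (Ioo 0 S) isOpen_Ioo :
        Opens (ℝ × EuclideanSpace ℝ (Fin 3))) : Set (ℝ × EuclideanSpace ℝ (Fin 3))),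
        ⟪E' z.1 z.2, gradient (θ z.1) z.2⟫ = 0 := by
      refine setIntegral_inner_gradient_eq_zero_of_iterated
        (Q := slab (EuclideanSpace ℝ (Fin 3)) (Ioo 0 S) isOpen_Ioo) hEloc (fun φ hφ => ?_) hθ
      obtain ⟨-, -, hφ0⟩ := hφ.continuous_gradient_field
      have hφQ := hφ.tsupport_subset
      have hslice : ∀ t, ∫ x, ⟪E' t x, gradient (φ t) x⟫ = 0 := by
        intro t
        by_cases ht : t ∈ Ioo 0 S
        · exact VectorCalculus.IsDivFree.isWeaklyDivFree_holds (hEdiv t ht.1)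
            ((hEsm t ht.1).of_le one_le_two) (φ t) ((hφ.mono le_top).isTestFunctionOn_slice t)
        · refine integral_eq_zero_of_ae (Eventually.of_forall fun x => ?_)
          have hz : ((t, x) : ℝ × EuclideanSpace ℝ (Fin 3)) ∉ tsupport (uncurry φ) := fun h =>
            ht (mem_slab.1 (hφQ h))
          simp only [hφ0 (t, x) hz, inner_zero_right, Pi.zero_apply]
      simp only [hslice, integral_zero]
    have huE : (fun z : ℝ × EuclideanSpace ℝ (Fin 3) =>
        ⟪(fun t x => u t x - E' t x) z.1 z.2, gradient (θ z.1) z.2⟫) =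
        fun z => ⟪u z.1 z.2, gradient (θ z.1) z.2⟫ - ⟪E' z.1 z.2, gradient (θ z.1) z.2⟫ := by
      funext z; exact inner_sub_left _ _ _
    rw [huE, integral_sub iu iE, hNS.2.2.2.1 θ hθ, hE0, sub_zero]
  · -- the momentum identity
    set Kψ : Set (ℝ × EuclideanSpace ℝ (Fin 3)) := tsupport (uncurry ψ) with hKψ
    have h0A : ∀ z ∉ Kψ, uncurry (timeDeriv ψ) z = 0 := fun z hz => timeDeriv_eq_zero_off_tsupport hz
    have h0B : ∀ z ∉ Kψ, (fun z : ℝ × EuclideanSpace ℝ (Fin 3) => (Δ (ψ z.1)) z.2) z = 0 := fun z hz =>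
      laplacian_eq_zero_of_notMem_tsupport (notMem_tsupport_slice_of_notMem hz)
    have h0C : ∀ z ∉ Kψ, (fun z : ℝ × EuclideanSpace ℝ (Fin 3) => VectorCalculus.divergence (ψ z.1) z.2) z = 0 :=
      fun z hz => divergence_eq_zero_of_notMem_tsupport (notMem_tsupport_slice_of_notMem hz)
    obtain ⟨hcA, hQA⟩ := hasCompactSupport_of_eq_zero_off_tsupport hψ h0A
    obtain ⟨hcB, hQB⟩ := hasCompactSupport_of_eq_zero_off_tsupport hψ h0B
    obtain ⟨hcC, hQC⟩ := hasCompactSupport_of_eq_zero_off_tsupport hψ h0C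
    have hA := integrableOn_inner_of_tsupport_subset (Ψ := uncurry (timeDeriv ψ)) hNS.1
      hψ.continuous_timeDeriv hcA hQA
    have hB := integrableOn_inner_of_tsupport_subset hNS.1 hψ.continuous_laplacian_slice hcB hQB
    have hC := integrableOn_mul_of_tsupport_subset hNS.2.2.1 hψ.continuous_divergence_slice hcC hQC
    have hE₁ := integrableOn_inner_of_tsupport_subset (Ψ := uncurry (timeDeriv ψ)) hEloc
      hψ.continuous_timeDeriv hcA hQA
    have hE₂ := integrableOn_inner_of_tsupport_subset hEloc hψ.continuous_laplacian_slice hcB hQB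
    obtain ⟨iF₄, iF₅, hN⟩ := setIntegral_slab_inner_convect_eq_neg hS hcont hK hdiv hmild hψ
    have hCal := setIntegral_slab_caloric_eq_zero hS hEc hEΔc hEsm hEt hψ
    have hNSψ := hNS.2.2.2.2 ψ hψ
    rw [coe_slab] at hNSψ hA hB hC hE₁ hE₂ ⊢
    -- the Navier–Stokes integrand is integrable
    have hNSint : IntegrableOn (fun z : ℝ × EuclideanSpace ℝ (Fin 3) =>
        ⟪u z.1 z.2, timeDeriv ψ z.1 z.2⟫ + ⟪u z.1 z.2, convect (u z.1) (ψ z.1) z.2⟫ +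
        1 * ⟪u z.1 z.2, (Δ (ψ z.1)) z.2⟫ + p z.1 z.2 * VectorCalculus.divergence (ψ z.1) z.2 +
        ⟪(0 : ℝ → EuclideanSpace ℝ (Fin 3) → EuclideanSpace ℝ (Fin 3)) z.1 z.2, ψ z.1 z.2⟫)
        (Ioo 0 S ×ˢ (univ : Set (EuclideanSpace ℝ (Fin 3)))) volume := by
      have h := ((hA.add iF₄).add (hB.const_mul 1)).add hC
      refine h.congr_fun (fun z _ => ?_) hSm
      simp [uncurry]
    have hEint : IntegrableOn (fun z : ℝ × EuclideanSpace ℝ (Fin 3) =>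
        ⟪E' z.1 z.2, timeDeriv ψ z.1 z.2⟫ + ⟪E' z.1 z.2, (Δ (ψ z.1)) z.2⟫)
        (Ioo 0 S ×ˢ (univ : Set (EuclideanSpace ℝ (Fin 3)))) volume :=
      (hE₁.add hE₂).congr_fun (fun z _ => by simp [uncurry]) hSm
    have hsplit : ∫ z in Ioo 0 S ×ˢ (univ : Set (EuclideanSpace ℝ (Fin 3))),
        (⟪(fun t x => u t x - E' t x) z.1 z.2, timeDeriv ψ z.1 z.2⟫ +
          ⟪(fun t x => u t x - E' t x) z.1 z.2, (Δ (ψ z.1)) z.2⟫ +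
          p z.1 z.2 * VectorCalculus.divergence (ψ z.1) z.2 +
          ⟪(fun t x => -(fderiv ℝ (u t) x (u t x))) z.1 z.2, ψ z.1 z.2⟫) =
        (∫ z in Ioo 0 S ×ˢ (univ : Set (EuclideanSpace ℝ (Fin 3))),
          (⟪u z.1 z.2, timeDeriv ψ z.1 z.2⟫ + ⟪u z.1 z.2, convect (u z.1) (ψ z.1) z.2⟫ +
          1 * ⟪u z.1 z.2, (Δ (ψ z.1)) z.2⟫ + p z.1 z.2 * VectorCalculus.divergence (ψ z.1) z.2 +
          ⟪(0 : ℝ → EuclideanSpace ℝ (Fin 3) → EuclideanSpace ℝ (Fin 3)) z.1 z.2, ψ z.1 z.2⟫)) -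
        (∫ z in Ioo 0 S ×ˢ (univ : Set (EuclideanSpace ℝ (Fin 3))),
          (⟪E' z.1 z.2, timeDeriv ψ z.1 z.2⟫ + ⟪E' z.1 z.2, (Δ (ψ z.1)) z.2⟫)) -
        ∫ z in Ioo 0 S ×ˢ (univ : Set (EuclideanSpace ℝ (Fin 3))),
          (⟪u z.1 z.2, convect (u z.1) (ψ z.1) z.2⟫ + ⟪fderiv ℝ (u z.1) z.2 (u z.1 z.2), ψ z.1 z.2⟫) := by
      have i45 : IntegrableOn (fun z : ℝ × EuclideanSpace ℝ (Fin 3) =>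
          ⟪u z.1 z.2, convect (u z.1) (ψ z.1) z.2⟫ + ⟪fderiv ℝ (u z.1) z.2 (u z.1 z.2), ψ z.1 z.2⟫)
          (Ioo 0 S ×ˢ (univ : Set (EuclideanSpace ℝ (Fin 3)))) volume := iF₄.add iF₅
      have iNE : IntegrableOn (fun z : ℝ × EuclideanSpace ℝ (Fin 3) =>
          (⟪u z.1 z.2, timeDeriv ψ z.1 z.2⟫ + ⟪u z.1 z.2, convect (u z.1) (ψ z.1) z.2⟫ +
            1 * ⟪u z.1 z.2, (Δ (ψ z.1)) z.2⟫ + p z.1 z.2 * VectorCalculus.divergence (ψ z.1) z.2 +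
            ⟪(0 : ℝ → EuclideanSpace ℝ (Fin 3) → EuclideanSpace ℝ (Fin 3)) z.1 z.2, ψ z.1 z.2⟫) -
          (⟪E' z.1 z.2, timeDeriv ψ z.1 z.2⟫ + ⟪E' z.1 z.2, (Δ (ψ z.1)) z.2⟫))
          (Ioo 0 S ×ˢ (univ : Set (EuclideanSpace ℝ (Fin 3)))) volume := hNSint.sub hEint
      rw [← integral_sub hNSint hEint, ← integral_sub iNE i45]
      refine setIntegral_congr_fun hSm fun z _ => ?_
      simp only [inner_sub_left, inner_neg_left, Pi.zero_apply, inner_zero_left, add_zero, one_mul]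
      ring
    rw [hsplit, hNSψ, hCal, integral_add iF₄ iF₅, hN]
    ring

/-- **Local energy equality for the remainder** `w = u − E` on `(0, S) × ℝ³`
(`IsDistributionalStokesSolutionOn.local_energy_equality`; all the local square-integrability
hypotheses hold by continuity on the open slab, the pressure being in `L²` of the slab): for every
`φ ∈ C_c^∞((0,S) × ℝ³)`,
`2∫∫|∇w|²φ = ∫∫ (|w|²(∂ₜφ + Δφ) + 2p⟪w, ∇φ⟫ + 2⟪−(u·∇)u, w⟫φ)`.
[cite: CaffarelliKohnNirenberg1982, §2 (2.5); BarkerSeregin2016, Lemma 3.4 (proof)] -/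
theorem remainder_local_energy_equality (hS : 0 < S)
    (hcont : ContinuousOn (uncurry u) (Icc 0 S ×ˢ univ)) {K : ℝ}
    (hK : ∀ t ∈ Icc 0 S, ∀ x, ‖u t x‖ ≤ K) (hdiv : ∀ t ∈ Icc 0 S, IsWeaklyDivFree (u t))
    (hmild : ∀ s t : ℝ, 0 ≤ s → s < t → t ≤ S → ∀ x,
      u t x = heatExtension (u s) (t - s) x - oseenDuhamel 1 s u u t x)
    (hEc : ContinuousOn (fun q : ℝ × EuclideanSpace ℝ (Fin 3) => E' q.1 q.2) (Ioi 0 ×ˢ univ))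
    (hEDc : ContinuousOn (fun q : ℝ × EuclideanSpace ℝ (Fin 3) => fderiv ℝ (E' q.1) q.2) (Ioi 0 ×ˢ univ))
    (hEΔc : ContinuousOn (fun q : ℝ × EuclideanSpace ℝ (Fin 3) => (Δ (E' q.1)) q.2) (Ioi 0 ×ˢ univ))
    (hEsm : ∀ t, 0 < t → ContDiff ℝ 2 (E' t)) (hEdiv : ∀ t, 0 < t → VectorCalculus.IsDivFree (E' t))
    (hEt : ∀ t, 0 < t → ∀ x, HasDerivAt (fun s => E' s x) ((Δ (E' t)) x) t)
    (hNS : IsDistributionalNSSolutionOn (slab (EuclideanSpace ℝ (Fin 3)) (Ioo 0 S) isOpen_Ioo) 1 0 u p)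
    (hp2 : MemLp (uncurry p) 2 (volume.restrict (Ioo 0 S ×ˢ (univ : Set (EuclideanSpace ℝ (Fin 3))))))
    {φ : ℝ → EuclideanSpace ℝ (Fin 3) → ℝ}
    (hφ : IsSpaceTimeTestOn (slab (EuclideanSpace ℝ (Fin 3)) (Ioo 0 S) isOpen_Ioo) φ) :
    2 * ∫ z in Ioo 0 S ×ˢ (univ : Set (EuclideanSpace ℝ (Fin 3))),
        frobeniusNormSq (fderiv ℝ (u z.1) z.2 - fderiv ℝ (E' z.1) z.2) * φ z.1 z.2 =
      ∫ z in Ioo 0 S ×ˢ (univ : Set (EuclideanSpace ℝ (Fin 3))),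
        (‖u z.1 z.2 - E' z.1 z.2‖ ^ 2 * (timeDeriv φ z.1 z.2 + (Δ (φ z.1)) z.2) +
          2 * (p z.1 z.2 * ⟪u z.1 z.2 - E' z.1 z.2, gradient (φ z.1) z.2⟫) +
          2 * (⟪-(fderiv ℝ (u z.1) z.2 (u z.1 z.2)), u z.1 z.2 - E' z.1 z.2⟫ * φ z.1 z.2)) := by
  obtain ⟨hSt, hWG⟩ := isDistributionalStokesSolutionOn_remainder hS hcont hK hdiv hmild hEc hEDc hEΔc
    hEsm hEdiv hEt hNS
  have hDu := continuousOn_fderiv_of_oseenForward hS hcont hK hdiv hmild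
  have hQI : Ioo 0 S ×ˢ (univ : Set (EuclideanSpace ℝ (Fin 3))) ⊆ Ioi 0 ×ˢ univ :=
    prod_mono (fun t ht => ht.1) Subset.rfl
  have hSm : MeasurableSet (Ioo 0 S ×ˢ (univ : Set (EuclideanSpace ℝ (Fin 3)))) :=
    measurableSet_Ioo.prod MeasurableSet.univ
  have cu : ContinuousOn (fun z : ℝ × EuclideanSpace ℝ (Fin 3) => u z.1 z.2) (Ioo 0 S ×ˢ univ) :=
    hcont.mono (prod_mono Ioo_subset_Icc_self Subset.rfl)
  have cw : ContinuousOn (fun z : ℝ × EuclideanSpace ℝ (Fin 3) => u z.1 z.2 - E' z.1 z.2) (Ioo 0 S ×ˢ univ) :=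
    cu.sub (hEc.mono hQI)
  have cG : ContinuousOn (fun z : ℝ × EuclideanSpace ℝ (Fin 3) => fderiv ℝ (u z.1) z.2 - fderiv ℝ (E' z.1) z.2)
      (Ioo 0 S ×ˢ univ) := hDu.sub (hEDc.mono hQI)
  have hu2 : LocallyIntegrableOn (fun z : ℝ × EuclideanSpace ℝ (Fin 3) =>
      ‖(fun t x => u t x - E' t x) z.1 z.2‖ ^ 2) (Ioo 0 S ×ˢ (univ : Set (EuclideanSpace ℝ (Fin 3)))) volume :=
    (cw.norm.pow 2).locallyIntegrableOn hSm
  have hG2 : LocallyIntegrableOn (fun z : ℝ × EuclideanSpace ℝ (Fin 3) =>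
      frobeniusNormSq ((fun t x => fderiv ℝ (u t) x - fderiv ℝ (E' t) x) z.1 z.2))
      (Ioo 0 S ×ˢ (univ : Set (EuclideanSpace ℝ (Fin 3)))) volume := by
    refine ContinuousOn.locallyIntegrableOn ?_ hSm
    unfold frobeniusNormSq
    exact continuousOn_finsetSum _ fun i _ => ((cG.clm_apply continuousOn_const).norm).pow 2
  have hp2' : LocallyIntegrableOn (fun z : ℝ × EuclideanSpace ℝ (Fin 3) => p z.1 z.2 ^ 2)
      (Ioo 0 S ×ˢ (univ : Set (EuclideanSpace ℝ (Fin 3)))) volume := by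
    have h : IntegrableOn (fun z : ℝ × EuclideanSpace ℝ (Fin 3) => p z.1 z.2 ^ 2)
        (Ioo 0 S ×ˢ (univ : Set (EuclideanSpace ℝ (Fin 3)))) volume := hp2.integrable_sq
    exact h.locallyIntegrableOn
  have hf2 : LocallyIntegrableOn (fun z : ℝ × EuclideanSpace ℝ (Fin 3) =>
      ‖(fun t x => -(fderiv ℝ (u t) x (u t x))) z.1 z.2‖ ^ 2)
      (Ioo 0 S ×ˢ (univ : Set (EuclideanSpace ℝ (Fin 3)))) volume :=
    ((hDu.clm_apply cu).neg.norm.pow 2).locallyIntegrableOn hSm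
  have key := hSt.local_energy_equality hWG hu2 hG2 hp2' hf2 hφ
  rw [coe_slab] at key
  exact key

end Stokes



end Literature.Analysis.FluidPDE

end
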